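import Summits.QuantumAdvantage.QuantumAdvantage.Theorems.PurityDialLawH

/-! # PurityDialLawI — part 9/13 (mechanical split for landing of `PurityDialLaw`; content verbatim; scopes re-opened with their variables) -/

set_option linter.dupNamespace false
noncomputable section

namespace Summit.QuantumAdvantage.QuantumAdvantage.Theorems.PurityDialLaw
open Classical Finset Summit.QuantumAdvantage.AdviceFreeQNC0
open Literature.Computability.MetaComplexity Literature.Computability.MetaComplexity.Smolensky
open Literature.Computability.Complexity (parityFn)

section Dense

variable {m : ℕ}

/-- **DENSE LEVEL SETS OBEY THE QUADRATIC LAW** (absolute Smolensky, PROVED): for an odd prime `p`, a Boolean function of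
`𝔽_p`-degree `≤ d` whose level set has DENSITY `≥ 2^{-k}` on `m ≥ (d+1)²·4^{k+1}` bits is `3`-balanced (Smolensky twice:
`|#odd − #even| ≤ d·C(m, m/2) ≤ d·2^m/√m ≤ 2^{m-k-1} ≤ #f / 2`).  At the conjectured threshold `m = A(d+1)²` this handles every
level set of density `≥ 2/√A`: a counterexample FAMILY to `RelSmolOdd` (which quantifies `∃ A`) must have density `→ 0`. -/
theorem relBal_three_of_dense {p : ℕ} [hp : Fact p.Prime] (hp2 : p ≠ 2) {d k : ℕ}
    (hm : (d + 1) ^ 2 * 4 ^ (k + 1) ≤ m) {f : (Fin m → Bool) → Bool} (hf : HasDegF p f d)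
    (hdense : 2 ^ m ≤ 2 ^ k * (univ.filter fun z => f z = true).card) : RelBal 3 f := by
  have h4 : 1 ≤ 4 ^ (k + 1) := Nat.one_le_pow _ _ (by norm_num)
  have hd1m : d + 1 ≤ m := by nlinarith
  have hm1 : 1 ≤ m := by omega
  have h2 : (2 : ZMod p) ≠ 0 := (by
    -- `2 ≠ 0` in `ZMod p`, `p ≠ 2` prime (inlined folklore; cf. KroneckerSplitting.two_ne_zero_zmod)
    intro h
    have h' : p ∣ 2 := by
      have : ((2 : ℕ) : ZMod p) = 0 := by exact_mod_cast h
      exact (ZMod.natCast_eq_zero_iff 2 p).1 this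
    exact hp2 ((Nat.prime_dvd_prime_iff_eq (Fact.out) Nat.prime_two).1 h'))
  set P : CubeFn (ZMod p) m := fun x => if f x = true then (1 : ZMod p) else 0 with hPdef
  have hP : P ∈ lowDeg (ZMod p) m d := hf
  have hQ : (1 - P) ∈ lowDeg (ZMod p) m d := Submodule.sub_mem _ (one_mem_lowDeg d) hP
  set a := (oddPart f).card with ha
  set b := (evenPart f).card with hb
  set X := d * m.choose (m / 2) with hX
  -- Smolensky for `P`: `a ≤ b + X`
  have hA1 : (univ.filter fun x => P x = if parityFn m x then 1 else 0).card ≤ 2 ^ (m - 1) + d * m.choose (m / 2) := by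
    convert parity_agreement_le' h2 hP using 3
  have hE := Summit.QuantumAdvantage.QuantumAdvantage.Theorems.PairFreezing.Pairing.card_filter_parityFn m hm1 false
  have hO := Summit.QuantumAdvantage.QuantumAdvantage.Theorems.PairFreezing.Pairing.card_filter_parityFn m hm1 true
  have hid1 : (univ.filter fun x => P x = if parityFn m x then 1 else 0).card + b =
      a + (univ.filter fun z : Fin m → Bool => parityFn m z = false).card := by
    rw [ha, hb]; unfold oddPart evenPart
    rw [← card_union_of_disjoint, ← card_union_of_disjoint]
    · congr 1; ext x; simp only [mem_union, mem_filter, mem_univ, true_and, hPdef]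
      cases hfx : f x <;> cases hpx : parityFn m x <;> simp
    · exact disjoint_filter.2 fun x _ h1 h3 => by rw [h1.2] at h3; exact Bool.noConfusion h3
    · refine disjoint_filter.2 fun x _ h1 h3 => ?_
      rw [hPdef] at h1; simp only at h1; rw [h3.1, h3.2] at h1; simp at h1
  have hab : a ≤ b + X := by rw [hE] at hid1; omega
  -- Smolensky for `1 − P`: `b ≤ a + X`
  have hA2 : (univ.filter fun x => (1 - P) x = if parityFn m x then 1 else 0).card ≤
      2 ^ (m - 1) + d * m.choose (m / 2) := by
    convert parity_agreement_le' h2 hQ using 3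
  have hid2 : (univ.filter fun x => (1 - P) x = if parityFn m x then 1 else 0).card + a =
      b + (univ.filter fun z : Fin m → Bool => parityFn m z = true).card := by
    rw [ha, hb]; unfold oddPart evenPart
    rw [← card_union_of_disjoint, ← card_union_of_disjoint]
    · congr 1; ext x; simp only [mem_union, mem_filter, mem_univ, true_and, hPdef, Pi.sub_apply, Pi.one_apply]
      cases hfx : f x <;> cases hpx : parityFn m x <;> simp
    · exact disjoint_filter.2 fun x _ h1 h3 => by rw [h1.2] at h3; exact Bool.noConfusion h3
    · refine disjoint_filter.2 fun x _ h1 h3 => ?_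
      rw [hPdef] at h1; simp only [Pi.sub_apply, Pi.one_apply] at h1; rw [h3.1, h3.2] at h1; simp at h1
  have hba : b ≤ a + X := by rw [hO] at hid2; omega
  -- density replaces DLSZ
  have hsupp : 2 ^ m ≤ 2 ^ k * (a + b) := by rw [← card_level_eq f]; exact hdense
  -- the real estimate `2·X·2^k ≤ 2^m`
  have hXR : (2 : ℝ) * X * 2 ^ k ≤ 2 ^ m := by
    have hC : ((m.choose (m / 2) : ℕ) : ℝ) ≤ 2 ^ m / Real.sqrt m := by
      have h := BlockParity.choose_half_mul_pow_le hm1 le_rfl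
      rwa [Nat.sub_self, pow_zero, mul_one] at h
    have hsq : ((d : ℝ) * 2 ^ (k + 1)) ^ 2 ≤ m := by
      have h1 : ((d ^ 2 * 4 ^ (k + 1) : ℕ) : ℝ) ≤ m := by
        have : d ^ 2 * 4 ^ (k + 1) ≤ m := le_trans (Nat.mul_le_mul_right _ (by nlinarith)) hm
        exact_mod_cast this
      have h2 : ((d : ℝ) * 2 ^ (k + 1)) ^ 2 = ((d ^ 2 * 4 ^ (k + 1) : ℕ) : ℝ) := by
        push_cast
        rw [mul_pow, ← pow_mul, show (4 : ℝ) = 2 ^ 2 by norm_num, ← pow_mul, mul_comm 2 (k + 1)]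
      rwa [h2]
    have hs : (d : ℝ) * 2 ^ (k + 1) ≤ Real.sqrt m := by
      have h0 : (0 : ℝ) ≤ d * 2 ^ (k + 1) := by positivity
      rw [← Real.sqrt_sq h0]
      exact Real.sqrt_le_sqrt hsq
    have hmpos : (0 : ℝ) < Real.sqrt m := Real.sqrt_pos.2 (by exact_mod_cast hm1)
    rw [hX]; push_cast
    calc (2 : ℝ) * (d * (m.choose (m / 2) : ℝ)) * 2 ^ k = (d * 2 ^ (k + 1)) * (m.choose (m / 2) : ℝ) := by ring
      _ ≤ (d * 2 ^ (k + 1)) * (2 ^ m / Real.sqrt m) := mul_le_mul_of_nonneg_left hC (by positivity)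
      _ ≤ Real.sqrt m * (2 ^ m / Real.sqrt m) := mul_le_mul_of_nonneg_right hs (by positivity)
      _ = 2 ^ m := by field_simp
  have h2X : 2 * X ≤ a + b := by
    have h1 : ((2 * X * 2 ^ k : ℕ) : ℝ) ≤ ((2 ^ m : ℕ) : ℝ) := by push_cast; exact hXR
    have h1' : 2 * X * 2 ^ k ≤ 2 ^ m := by exact_mod_cast h1
    have h3 : 2 * X * 2 ^ k ≤ (a + b) * 2 ^ k := by rw [mul_comm (a + b)]; exact h1'.trans hsupp
    exact Nat.le_of_mul_le_mul_right h3 (by positivity)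
  exact ⟨by omega, by omega⟩

/-- density form used by the normal form: NOT `3`-balanced at degree `≤ d` on `m ≥ (d+1)²·4^{k+1}` bits ⇒ density `< 2^{-k}`. -/
theorem card_lt_of_not_relBal {p : ℕ} [Fact p.Prime] (hp2 : p ≠ 2) {d k : ℕ} (hm : (d + 1) ^ 2 * 4 ^ (k + 1) ≤ m)
    {f : (Fin m → Bool) → Bool} (hf : HasDegF p f d) (hnb : ¬ RelBal 3 f) :
    2 ^ k * (univ.filter fun z => f z = true).card < 2 ^ m := by
  by_contra hge
  exact hnb (relBal_three_of_dense hp2 hm hf (not_lt.1 hge))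

end Dense

section CellForm

variable {k r : ℕ}

/-- the fibre of `f` over `u` (the trailing `r` coordinates frozen to `u`) as a function on the leading `k`-cube. -/
def fibreFn (f : (Fin (k + r) → Bool) → Bool) (u : Fin r → Bool) : (Fin k → Bool) → Bool := fun y => f (Fin.append y u)

/-- Purity-dial helper `hasDegF_fibreFn` (lens-4 g6 PurityDialLaw v12 twin; see the enclosing section docstring). -/
theorem hasDegF_fibreFn (p : ℕ) [Fact p.Prime] {d : ℕ} {f : (Fin (k + r) → Bool) → Bool} (hf : HasDegF p f d)
    (u : Fin r → Bool) : HasDegF p (fibreFn f u) d :=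
  fibre_mem_lowDeg p hf u

/-- Purity-dial helper `fibrePart_eq_card_part_fibreFn` (lens-4 g6 PurityDialLaw v12 twin; see the enclosing section docstring). -/
theorem fibrePart_eq_card_part_fibreFn (f : (Fin (k + r) → Bool) → Bool) (u : Fin r → Bool) (b : Bool) :
    fibrePart f u b = (univ.filter fun y : Fin k → Bool => fibreFn f u y = true ∧ parityFn k y = b).card := rfl

/-- **FIBREWISE BALANCE ⇒ BALANCE (PROVED; the census' monotonicity lemma `ρ(p,d,m)` non-increasing in `m`).**  If every
fibre of `f` over the trailing `r` coordinates is `R`-balanced then `f` is `R`-balanced: `#odd f = Σ_{u even} O_u + Σ_{u odd} E_u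
≤ R·(Σ_{u even} E_u + Σ_{u odd} O_u) = R·#even f`. -/
theorem relBal_of_fibres {R : ℕ} (f : (Fin (k + r) → Bool) → Bool) (hfib : ∀ u, RelBal R (fibreFn f u)) : RelBal R f := by
  have hO : ∀ u, fibrePart f u true ≤ R * fibrePart f u false := fun u => (hfib u).1
  have hE : ∀ u, fibrePart f u false ≤ R * fibrePart f u true := fun u => (hfib u).2
  unfold RelBal oddPart evenPart
  rw [card_part_eq_sum_fibre f true, card_part_eq_sum_fibre f false, Finset.mul_sum, Finset.mul_sum]
  constructor
  · refine Finset.sum_le_sum fun u _ => ?_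
    rcases Bool.eq_false_or_eq_true (parityFn r u) with hu | hu <;> rw [hu]
    · simpa using hE u
    · simpa using hO u
  · refine Finset.sum_le_sum fun u _ => ?_
    rcases Bool.eq_false_or_eq_true (parityFn r u) with hu | hu <;> rw [hu]
    · simpa using hO u
    · simpa using hE u

/-- **THE CELL FORM (PROVED): one certified cell certifies all larger `m`.**  If every degree-`≤ d` Boolean function on EXACTLY
`m₀` bits is `R`-balanced, then so is every degree-`≤ d` Boolean function on any `m ≥ m₀` bits (freeze the extra `m − m₀`
coordinates: each fibre is a degree-`≤ d` function on `m₀` bits).  Each census cell `(p, d, m₀)` certified `ρ ≤ 1/2` is thereby an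
in-Lean lemma for all `m ≥ m₀` at that `(p, d)`. -/
theorem cell_mono (p : ℕ) [Fact p.Prime] {R d m₀ : ℕ}
    (hcell : ∀ g : (Fin m₀ → Bool) → Bool, HasDegF p g d → RelBal R g) :
    ∀ m : ℕ, m₀ ≤ m → ∀ f : (Fin m → Bool) → Bool, HasDegF p f d → RelBal R f := by
  intro m hm f hf
  obtain ⟨r, rfl⟩ := Nat.exists_eq_add_of_le hm
  exact relBal_of_fibres f fun u => hcell _ (hasDegF_fibreFn p hf u)

/-- **`LawAt` IN CELL FORM (PROVED):** the dial member `LawAt p R τ` is equivalent to its restriction to the cells `m = τ d`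
exactly — `∀ d`, every degree-`≤ d` function on EXACTLY `τ d` bits is `R`-balanced. -/
theorem lawAt_iff_cells (p : ℕ) [Fact p.Prime] (R : ℕ) (τ : ℕ → ℕ) :
    LawAt p R τ ↔ ∀ d : ℕ, ∀ g : (Fin (τ d) → Bool) → Bool, HasDegF p g d → RelBal R g :=
  ⟨fun h d g hg => h (τ d) d le_rfl g hg, fun h m d hm f hf => cell_mono p (h d) m hm f hf⟩

/-- hence the law `RelSmolLaw p R B` in cell form: `∃ A, ∀ d`, every degree-`≤ d` function on exactly `A(d+1)^B` bits is
`R`-balanced. -/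
theorem relSmolLaw_iff_cells (p : ℕ) [Fact p.Prime] (R B : ℕ) :
    RelSmolLaw p R B ↔ ∃ A : ℕ, ∀ d : ℕ, ∀ g : (Fin (A * (d + 1) ^ B) → Bool) → Bool, HasDegF p g d → RelBal R g := by
  unfold RelSmolLaw
  exact exists_congr fun A => lawAt_iff_cells p R _

/-- **ITEM 29180 IN CELL FORM (PROVED).**  `RelSmolOdd` is equivalent to: for every prime `p ≥ 5` there is `A` such that
for every `d`, every degree-`≤ d` Boolean function on EXACTLY `A(d+1)²` bits is `3`-balanced — ONE cell per degree (a
certified census cell `ρ(p,d,m₀) ≤ 1/2` is an instance, valid for all `m ≥ m₀` by `cell_mono`). -/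
theorem relSmolOdd_iff_cells :
    Theses.PolyFeatureDial.RelSmolOdd ↔ ∀ (p : ℕ) [Fact p.Prime], 5 ≤ p →
      ∃ A : ℕ, ∀ d : ℕ, ∀ g : (Fin (A * (d + 1) ^ 2) → Bool) → Bool, HasDegF p g d → RelBal 3 g :=
  forall_congr' fun p => forall_congr' fun _ => forall_congr' fun _ => relSmolLaw_iff_cells p 3 2

end CellForm


end Summit.QuantumAdvantage.QuantumAdvantage.Theorems.PurityDialLaw
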